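import Summits.Ventures.PercRepro.RankLevelSetAbsorbStarLarge

/-! # RankLevelSetAbsorbStarFourExcess — TWO DOWN-NEIGHBOURS OF EXCESS `2` LEAVE NO THIRD (night-1 g36; dossier
§48.10; on `RankLevelSetAbsorbStarLarge`)

The structural fact behind the step `k = 4` of (ABS-star) for `#E ≥ 11` (`RankLevelSetAbsorbStarFourEleven`): on a
coloop-free matroid with `10 ≤ #E`, a member `W ∈ A^y_5` whose down-neighbours `Z₁ = W ∖ {e₁}` and `Z₂ = W ∖ {e₂}`
both have excess `2` has no third down-neighbour (**`card_downNbrs_le_two_of_two_excess`**). With `{a, b}` the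
excess of `Z₁` and `P := E ∖ (Z₁ ∪ {y, a, b})` (`#P = #E − 7 ≥ 3`, `e₁ ∈ P`): the excess of `Z₂` avoids `e₂` (`W` is
independent) and avoids `P ∖ {e₁}` — for `p ∈ P ∖ {e₁}` and a third `p'' ∈ P`, `E ∖ {p, p''} ⊆ cl Z₁ ∪ (P ∖ {p, p''})`
has rank `≤ 4 + (#E − 9) < #E − 4 ≤ rk M`, so it does not span, while `p ∈ cl Z₂ ⊆ cl (E ∖ {p, p''})` would make it
span together with the non-coloop `p''` (`spanning_sdiff_pair_of_mem_closure`) — hence the excess of `Z₂` is `{a, b}`;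
exchange with `e₁ ∉ cl Z₁` puts `a`, `b` and `y` in `cl (Z₁ ∖ {e₂})`, so `E ∖ {e₁, e₂} ⊆ cl (Z₁ ∖ {e₂}) ∪ (P ∖ {e₁})`
has rank `≤ 3 + (#E − 8) = #E − 5`, and a third `W ∖ {e₃}` would have an independent complement of `#E − 4` elements
inside it. Every declaration has a docstring; imports: the cell's own modules and Mathlib only. Axioms: standard. -/

namespace PercRepro

open Set Matroid

variable {α : Type} [DecidableEq α] (M : Matroid α) [M.Finite]


/-! ## Two rank facts -/

omit [DecidableEq α] [M.Finite] in
/-- If `X ⊆ cl Y ∪ R`, then `eRk X ≤ eRk Y + #R`. -/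
lemma eRk_le_of_subset_closure_union {X Y R : Set α} (h : X ⊆ M.closure Y ∪ R) :
    M.eRk X ≤ M.eRk Y + R.encard := by
  calc M.eRk X ≤ M.eRk (M.closure Y ∪ R) := M.eRk_mono h
    _ ≤ M.eRk (M.closure Y) + R.encard := M.eRk_union_le_eRk_add_encard _ _
    _ = M.eRk Y + R.encard := by rw [M.eRk_closure_eq]

omit [DecidableEq α] [M.Finite] in
/-- If `p ∈ cl (E ∖ {p, p''})` and `p''` is not a coloop, then `E ∖ {p, p''}` spans. -/
lemma spanning_sdiff_pair_of_mem_closure {p p'' : α} (hcol : ¬ M.IsColoop p'')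
    (h : p ∈ M.closure (M.E \ {p, p''})) : M.Spanning (M.E \ {p, p''}) := by
  have hsp : M.Spanning (M.E \ {p''}) := by
    by_contra hns
    exact hcol (Matroid.isColoop_iff_sdiff_not_spanning.mpr hns)
  refine ⟨?_, Set.sdiff_subset⟩
  have hsub : M.E \ {p''} ⊆ M.closure (M.E \ {p, p''}) := by
    intro x hx
    by_cases hxp : x = p
    · rw [hxp]; exact h
    · refine M.subset_closure _ Set.sdiff_subset ⟨hx.1, ?_⟩
      simp only [Set.mem_insert_iff, Set.mem_singleton_iff, not_or]
      exact ⟨hxp, by simpa using hx.2⟩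
  have hcl : M.closure (M.E \ {p''}) ⊆ M.closure (M.E \ {p, p''}) :=
    Matroid.closure_subset_closure_of_subset_closure hsub
  rw [hsp.closure_eq] at hcl
  exact subset_antisymm (M.closure_subset_ground _) hcl

/-! ## The structural fact: two down-neighbours of excess `2` leave no third -/

/-- **At most two down-neighbours when two of them have excess `2`** (coloop-free `M`, `10 ≤ #E`, level `4 → 5`). -/
theorem card_downNbrs_le_two_of_two_excess (hcol : ∀ e, ¬ M.IsColoop e) {y : α} (hy : y ∈ M.E)
    (hn : 10 ≤ M.E.ncard) {W : Finset α} (hW : W ∈ absorbFinset M y 5) {Z₁ Z₂ : Finset α}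
    (hZ₁ : Z₁ ∈ downNbrs M y 4 W) (hZ₂ : Z₂ ∈ downNbrs M y 4 W) (hne : Z₁ ≠ Z₂)
    (hex₁ : (exFinset M y Z₁).card = 2) (hex₂ : (exFinset M y Z₂).card = 2) :
    (downNbrs M y 4 W).card ≤ 2 := by
  obtain ⟨e₁, he₁W, hZ₁eq, he₁Z⟩ := exists_erase_of_mem_downNbrs M hW hZ₁
  obtain ⟨e₂, he₂W, hZ₂eq, he₂Z⟩ := exists_erase_of_mem_downNbrs M hW hZ₂
  have he12 : e₁ ≠ e₂ := fun h => hne (by rw [hZ₁eq, hZ₂eq, h])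
  have hW' := (mem_absorbFinset M).mp hW
  have hZ₁A : Z₁ ∈ absorbFinset M y 4 := (Finset.mem_filter.mp hZ₁).1
  have hZ₁' := (mem_absorbFinset M).mp hZ₁A
  have hZ₂A : Z₂ ∈ absorbFinset M y 4 := (Finset.mem_filter.mp hZ₂).1
  have hZ₂' := (mem_absorbFinset M).mp hZ₂A
  have hycl₁ : y ∈ M.closure (↑Z₁ : Set α) := mem_closure_of_mem_lowAbsorbAt M hy hZ₁'
  have hycl₂ : y ∈ M.closure (↑Z₂ : Set α) := mem_closure_of_mem_lowAbsorbAt M hy hZ₂'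
  obtain ⟨⟨hWE, -, hWi, -⟩, hyW, -⟩ := hW'
  obtain ⟨⟨hZ₁E, hZ₁4, hZ₁i, hZ₁c⟩, hyZ₁, -⟩ := hZ₁'
  have hZ₁W : Z₁ ⊆ W := by rw [hZ₁eq]; exact Finset.erase_subset e₁ W
  have hZ₂W : Z₂ ⊆ W := by rw [hZ₂eq]; exact Finset.erase_subset e₂ W
  have he₂Z₁ : e₂ ∈ Z₁ := by rw [hZ₁eq]; exact Finset.mem_erase.mpr ⟨he12.symm, he₂W⟩
  have hcoe₁ : (↑Z₁ : Set α) = (↑W : Set α) \ {e₁} := by rw [hZ₁eq, Finset.coe_erase]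
  have hcoe₂ : (↑Z₂ : Set α) = (↑W : Set α) \ {e₂} := by rw [hZ₂eq, Finset.coe_erase]
  have hZ₁card : Z₁.card = 4 := by have := hZ₁4; rwa [Set.ncard_coe_finset] at this
  have he₁cl : e₁ ∉ M.closure (↑Z₁ : Set α) := by
    rw [hcoe₁]; exact hWi.notMem_closure_sdiff_of_mem (by simpa using he₁W)
  have he₁y : e₁ ≠ y := fun h => hyW (h ▸ he₁W)
  have he₁E : e₁ ∈ M.E := hWE (by simpa using he₁W)
  -- the excess `{a, b}` of `Z₁`
  obtain ⟨a, b, hab, hX⟩ := Finset.card_eq_two.mp hex₁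
  have ha : a ∈ exFinset M y Z₁ := by rw [hX]; exact Finset.mem_insert_self a _
  have hb : b ∈ exFinset M y Z₁ := by rw [hX]; exact Finset.mem_insert_of_mem (Finset.mem_singleton_self b)
  rw [mem_exFinset] at ha hb
  have haE : a ∈ M.E := M.closure_subset_ground _ ha.1
  have hbE : b ∈ M.E := M.closure_subset_ground _ hb.1
  have hae₁ : a ≠ e₁ := fun h => he₁cl (h ▸ ha.1)
  have hbe₁ : b ≠ e₁ := fun h => he₁cl (h ▸ hb.1)
  have haW : a ∉ W := fun haW => ha.2.2 (by rw [hZ₁eq]; exact Finset.mem_erase.mpr ⟨hae₁, haW⟩)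
  have hbW : b ∉ W := fun hbW => hb.2.2 (by rw [hZ₁eq]; exact Finset.mem_erase.mpr ⟨hbe₁, hbW⟩)
  -- the rest `P := E ∖ (Z₁ ∪ {y, a, b})`, `#P = #E − 7`
  set Q : Finset α := insert y (insert a (insert b Z₁)) with hQ
  set P : Finset α := absGround M \ Q with hP
  have hQcard : Q.card = 7 := by
    rw [hQ, Finset.card_insert_of_notMem, Finset.card_insert_of_notMem, Finset.card_insert_of_notMem, hZ₁card]
    · exact hb.2.2
    · simp only [Finset.mem_insert, not_or]; exact ⟨hab, ha.2.2⟩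
    · simp only [Finset.mem_insert, not_or]
      exact ⟨ha.2.1.symm, hb.2.1.symm, by simpa using hyZ₁⟩
  have hQE : Q ⊆ absGround M := by
    intro x hx
    rw [mem_absGround]
    simp only [hQ, Finset.mem_insert] at hx
    rcases hx with rfl | rfl | rfl | hx
    · exact hy
    · exact haE
    · exact hbE
    · exact hZ₁E (by simpa using hx)
  have hPcard : P.card = M.E.ncard - 7 := by
    rw [hP, Finset.card_sdiff_of_subset hQE, card_absGround, hQcard]
  have hmemP : ∀ x, x ∈ P ↔ x ∈ M.E ∧ x ≠ y ∧ x ≠ a ∧ x ≠ b ∧ x ∉ Z₁ := by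
    intro x
    rw [hP, Finset.mem_sdiff, mem_absGround, hQ]
    simp only [Finset.mem_insert, not_or]
  have he₁P : e₁ ∈ P := (hmemP e₁).mpr ⟨he₁E, he₁y, hae₁.symm, hbe₁.symm, he₁Z⟩
  -- `Q ⊆ cl Z₁`, `eRk (cl Z₁) = 4`, `rk M ≥ #E − 4`
  have hQcl : ∀ x ∈ Q, x ∈ M.closure (↑Z₁ : Set α) := by
    intro x hx
    simp only [hQ, Finset.mem_insert] at hx
    rcases hx with rfl | rfl | rfl | hx
    · exact hycl₁
    · exact ha.1
    · exact hb.1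
    · exact M.subset_closure _ hZ₁E (by simpa using hx)
  have hcl4 : M.eRk (↑Z₁ : Set α) = 4 := by
    rw [hZ₁i.eRk_eq_encard, Set.encard_coe_eq_coe_finsetCard, hZ₁card]; rfl
  have hrank : ((M.E.ncard - 4 : ℕ) : ℕ∞) ≤ M.eRank := by
    have h := hZ₁c.encard_le_eRank
    rwa [← (M.ground_finite.subset Set.sdiff_subset).cast_ncard_eq,
      Set.ncard_sdiff hZ₁E (M.ground_finite.subset hZ₁E), hZ₁4] at h
  -- (K1a) the excess of `Z₂` lies in `{a, b}`
  have hexsub : exFinset M y Z₂ ⊆ {a, b} := by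
    intro e he
    rw [mem_exFinset] at he
    obtain ⟨hecl, hey, heZ₂⟩ := he
    by_contra heab
    simp only [Finset.mem_insert, Finset.mem_singleton, not_or] at heab
    have heE : e ∈ M.E := M.closure_subset_ground _ hecl
    have hee₂ : e ≠ e₂ := by
      intro h
      rw [h, hcoe₂] at hecl
      exact hWi.notMem_closure_sdiff_of_mem (by simpa using he₂W) hecl
    have heW : e ∉ W := fun h => heZ₂ (by rw [hZ₂eq]; exact Finset.mem_erase.mpr ⟨hee₂, h⟩)
    have heP : e ∈ P := (hmemP e).mpr ⟨heE, hey, heab.1, heab.2, fun h => heW (hZ₁W h)⟩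
    have hee₁ : e ≠ e₁ := fun h => heW (h ▸ he₁W)
    -- a third element `p` of `P`
    obtain ⟨p, hp⟩ : ((P.erase e₁).erase e).Nonempty := by
      rw [← Finset.card_pos, Finset.card_erase_of_mem (Finset.mem_erase.mpr ⟨hee₁, heP⟩),
        Finset.card_erase_of_mem he₁P, hPcard]
      omega
    have hpe : p ≠ e := (Finset.mem_erase.mp hp).1
    have hpe₁ : p ≠ e₁ := (Finset.mem_erase.mp (Finset.mem_erase.mp hp).2).1
    have hpP : p ∈ P := (Finset.mem_erase.mp (Finset.mem_erase.mp hp).2).2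
    have hpP' := (hmemP p).mp hpP
    have hpW : p ∉ W := fun hpW => hpP'.2.2.2.2 (by rw [hZ₁eq]; exact Finset.mem_erase.mpr ⟨hpe₁, hpW⟩)
    -- `Z₂ ⊆ E ∖ {e, p}`, so `e ∈ cl (E ∖ {e, p})` and `E ∖ {e, p}` spans
    have hZ₂sub : (↑Z₂ : Set α) ⊆ M.E \ {e, p} := by
      intro x hx
      have hxW : x ∈ W := hZ₂W (by simpa using hx)
      refine ⟨hWE (by simpa using hxW), ?_⟩
      simp only [Set.mem_insert_iff, Set.mem_singleton_iff, not_or]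
      exact ⟨fun h => heW (h ▸ hxW), fun h => hpW (h ▸ hxW)⟩
    have hespan : M.Spanning (M.E \ {e, p}) :=
      spanning_sdiff_pair_of_mem_closure M (hcol p) (M.closure_subset_closure hZ₂sub hecl)
    -- but `E ∖ {e, p} ⊆ cl Z₁ ∪ (P ∖ {e, p})` has rank `≤ 4 + (#E − 9) < #E − 4`
    have hsub : M.E \ {e, p} ⊆ M.closure (↑Z₁ : Set α) ∪ (↑((P.erase e₁).erase e |>.erase p) ∪ {e₁}) := by
      intro x hx
      by_cases hxQ : x ∈ Q
      · exact Or.inl (hQcl x hxQ)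
      · have hxP : x ∈ P := Finset.mem_sdiff.mpr ⟨(mem_absGround M).mpr hx.1, hxQ⟩
        have hxe : x ≠ e := fun h => hx.2 (by rw [h]; exact Set.mem_insert e _)
        have hxp : x ≠ p := fun h => hx.2 (by rw [h]; exact Set.mem_insert_of_mem e rfl)
        by_cases hxe₁ : x = e₁
        · exact Or.inr (Or.inr (by rw [hxe₁]; exact Set.mem_singleton e₁))
        · exact Or.inr (Or.inl (by
            rw [Finset.mem_coe, Finset.mem_erase, Finset.mem_erase, Finset.mem_erase]
            exact ⟨hxp, hxe, hxe₁, hxP⟩))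
    have hcardR : ((P.erase e₁).erase e |>.erase p).card = M.E.ncard - 10 := by
      rw [Finset.card_erase_of_mem (Finset.mem_erase.mpr ⟨hpe, Finset.mem_erase.mpr ⟨hpe₁, hpP⟩⟩),
        Finset.card_erase_of_mem (Finset.mem_erase.mpr ⟨hee₁, heP⟩), Finset.card_erase_of_mem he₁P, hPcard]
      omega
    have hencR : (↑((P.erase e₁).erase e |>.erase p) ∪ ({e₁} : Set α)).encard ≤ ((M.E.ncard - 9 : ℕ) : ℕ∞) := by
      calc (↑((P.erase e₁).erase e |>.erase p) ∪ ({e₁} : Set α)).encard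
          ≤ (↑((P.erase e₁).erase e |>.erase p) : Set α).encard + ({e₁} : Set α).encard :=
            Set.encard_union_le _ _
        _ = ((M.E.ncard - 10 : ℕ) : ℕ∞) + 1 := by
            rw [Set.encard_coe_eq_coe_finsetCard, hcardR, Set.encard_singleton]
        _ = ((M.E.ncard - 9 : ℕ) : ℕ∞) := by norm_cast; omega
    have h1 : M.eRank ≤ ((4 + (M.E.ncard - 9) : ℕ) : ℕ∞) := by
      rw [← hespan.eRk_eq]
      calc M.eRk (M.E \ {e, p}) ≤ M.eRk (↑Z₁ : Set α) +
            (↑((P.erase e₁).erase e |>.erase p) ∪ ({e₁} : Set α)).encard := eRk_le_of_subset_closure_union M hsub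
        _ ≤ 4 + ((M.E.ncard - 9 : ℕ) : ℕ∞) := by rw [hcl4]; gcongr
        _ = ((4 + (M.E.ncard - 9) : ℕ) : ℕ∞) := by norm_cast
    have h2 : ((M.E.ncard - 4 : ℕ) : ℕ∞) ≤ ((4 + (M.E.ncard - 9) : ℕ) : ℕ∞) := hrank.trans h1
    have h3 : M.E.ncard - 4 ≤ 4 + (M.E.ncard - 9) := by exact_mod_cast h2
    omega
  -- so the excess of `Z₂` is exactly `{a, b}`
  have hexeq : exFinset M y Z₂ = {a, b} := by
    refine Finset.eq_of_subset_of_card_le hexsub ?_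
    rw [hex₂, Finset.card_pair hab]
  have hacl₂ : a ∈ M.closure (↑Z₂ : Set α) := by
    have : a ∈ exFinset M y Z₂ := by rw [hexeq]; exact Finset.mem_insert_self a _
    exact ((mem_exFinset M).mp this).1
  have hbcl₂ : b ∈ M.closure (↑Z₂ : Set α) := by
    have : b ∈ exFinset M y Z₂ := by rw [hexeq]; exact Finset.mem_insert_of_mem (Finset.mem_singleton_self b)
    exact ((mem_exFinset M).mp this).1
  -- (K1b) `a, b, y ∈ cl (Z₁ ∖ {e₂})`: exchange with `e₁ ∉ cl Z₁`
  have hZ₂set : (↑Z₂ : Set α) = insert e₁ ((↑Z₁ : Set α) \ {e₂}) := by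
    rw [hcoe₂, hcoe₁]
    ext x
    simp only [Set.mem_sdiff, Set.mem_singleton_iff, Set.mem_insert_iff, Finset.mem_coe]
    constructor
    · rintro ⟨hxW, hxe₂⟩
      by_cases hxe₁ : x = e₁
      · exact Or.inl hxe₁
      · exact Or.inr ⟨⟨hxW, hxe₁⟩, hxe₂⟩
    · rintro (rfl | ⟨⟨hxW, -⟩, hxe₂⟩)
      · exact ⟨he₁W, he12⟩
      · exact ⟨hxW, hxe₂⟩
  have hexch : ∀ x, x ∈ M.closure (↑Z₁ : Set α) → x ∈ M.closure (↑Z₂ : Set α) →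
      x ∈ M.closure ((↑Z₁ : Set α) \ {e₂}) := by
    intro x hx₁ hx₂
    by_contra hxn
    rw [hZ₂set] at hx₂
    have := Matroid.closure_exchange ⟨hx₂, hxn⟩
    apply he₁cl
    refine M.closure_subset_closure_of_subset_closure ?_ this.1
    intro z hz
    rcases hz with rfl | hz
    · exact hx₁
    · exact M.subset_closure _ hZ₁E (Finset.mem_coe.mpr hz.1)
  have ha' := hexch a ha.1 hacl₂
  have hb' := hexch b hb.1 hbcl₂
  have hy' := hexch y hycl₁ hycl₂
  -- (K2) `E ∖ {e₁, e₂} ⊆ cl (Z₁ ∖ {e₂}) ∪ (P ∖ {e₁})`, of rank `≤ 3 + (#E − 8)`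
  have hZ₁e₂ : M.eRk ((↑Z₁ : Set α) \ {e₂}) = 3 := by
    rw [(hZ₁i.subset Set.sdiff_subset).eRk_eq_encard, ← Finset.coe_erase, Set.encard_coe_eq_coe_finsetCard,
      Finset.card_erase_of_mem he₂Z₁, hZ₁card]
    rfl
  have hsub2 : M.E \ {e₁, e₂} ⊆ M.closure ((↑Z₁ : Set α) \ {e₂}) ∪ ↑(P.erase e₁) := by
    intro x hx
    have hxe₁ : x ≠ e₁ := fun h => hx.2 (by rw [h]; exact Set.mem_insert e₁ _)
    have hxe₂ : x ≠ e₂ := fun h => hx.2 (by rw [h]; exact Set.mem_insert_of_mem e₁ rfl)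
    by_cases hxQ : x ∈ Q
    · left
      simp only [hQ, Finset.mem_insert] at hxQ
      rcases hxQ with rfl | rfl | rfl | hxZ
      · exact hy'
      · exact ha'
      · exact hb'
      · exact M.subset_closure _ (Set.sdiff_subset.trans hZ₁E) ⟨Finset.mem_coe.mpr hxZ, by simpa using hxe₂⟩
    · right
      rw [Finset.mem_coe, Finset.mem_erase]
      exact ⟨hxe₁, Finset.mem_sdiff.mpr ⟨(mem_absGround M).mpr hx.1, hxQ⟩⟩
  have hrk2 : M.eRk (M.E \ {e₁, e₂}) ≤ ((3 + (M.E.ncard - 8) : ℕ) : ℕ∞) := by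
    calc M.eRk (M.E \ {e₁, e₂}) ≤ M.eRk ((↑Z₁ : Set α) \ {e₂}) + (↑(P.erase e₁) : Set α).encard :=
          eRk_le_of_subset_closure_union M hsub2
      _ = ((3 + (M.E.ncard - 8) : ℕ) : ℕ∞) := by
          rw [hZ₁e₂, Set.encard_coe_eq_coe_finsetCard, Finset.card_erase_of_mem he₁P, hPcard]
          norm_cast
  -- (K3) every down-neighbour is `Z₁` or `Z₂`
  have hsub3 : downNbrs M y 4 W ⊆ {Z₁, Z₂} := by
    intro Z₃ hZ₃
    obtain ⟨e₃, he₃W, hZ₃eq, -⟩ := exists_erase_of_mem_downNbrs M hW hZ₃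
    by_contra hZ₃n
    simp only [Finset.mem_insert, Finset.mem_singleton, not_or] at hZ₃n
    have he₃₁ : e₃ ≠ e₁ := fun h => hZ₃n.1 (by rw [hZ₃eq, hZ₁eq, h])
    have he₃₂ : e₃ ≠ e₂ := fun h => hZ₃n.2 (by rw [hZ₃eq, hZ₂eq, h])
    have hZ₃A : Z₃ ∈ absorbFinset M y 4 := (Finset.mem_filter.mp hZ₃).1
    obtain ⟨⟨hZ₃E, hZ₃4, -, hZ₃c⟩, -, -⟩ := (mem_absorbFinset M).mp hZ₃A
    -- `E ∖ Z₃ ⊆ E ∖ {e₁, e₂}` is independent with `#E − 4` elements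
    have hsub4 : M.E \ (↑Z₃ : Set α) ⊆ M.E \ {e₁, e₂} := by
      intro x hx
      refine ⟨hx.1, ?_⟩
      simp only [Set.mem_insert_iff, Set.mem_singleton_iff, not_or]
      constructor
      · rintro rfl
        exact hx.2 (by rw [hZ₃eq, Finset.coe_erase]; exact ⟨by simpa using he₁W, by simpa using he₃₁.symm⟩)
      · rintro rfl
        exact hx.2 (by rw [hZ₃eq, Finset.coe_erase]; exact ⟨by simpa using he₂W, by simpa using he₃₂.symm⟩)
    have h1 : ((M.E.ncard - 4 : ℕ) : ℕ∞) ≤ ((3 + (M.E.ncard - 8) : ℕ) : ℕ∞) := by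
      calc ((M.E.ncard - 4 : ℕ) : ℕ∞) = (M.E \ (↑Z₃ : Set α)).encard := by
            rw [← (M.ground_finite.subset Set.sdiff_subset).cast_ncard_eq,
              Set.ncard_sdiff hZ₃E (M.ground_finite.subset hZ₃E), hZ₃4]
        _ = M.eRk (M.E \ (↑Z₃ : Set α)) := hZ₃c.eRk_eq_encard.symm
        _ ≤ M.eRk (M.E \ {e₁, e₂}) := M.eRk_mono hsub4
        _ ≤ _ := hrk2
    have h2 : M.E.ncard - 4 ≤ 3 + (M.E.ncard - 8) := by exact_mod_cast h1
    omega
  exact (Finset.card_le_card hsub3).trans Finset.card_le_two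

end PercRepro
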